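import Summits.BirchSwinnertonDyer.Rank1Residual.Additive.GordRankOneKatoBranchGrossZagierOdd
import Summits.BirchSwinnertonDyer.Rank1Residual.Additive.ReductionNonAnomalousTwist
import Summits.BirchSwinnertonDyer.Rank1Residual.Additive.CensusQ6GordRecordIffCertificate
import HarnessLib

/-!
# The (G)-cell, ODD branch `p ≡ 3 (mod 4)`, `p ≥ 7`, rank one: the CERT-version iff
# `BranchPAdicGrossZagierOddAt ↔ BSD(E,p)` in CENSUS-LITERAL currency — the non-anomalous binder as
# `¬ p ∣ a_p(E♭) − 1` (n1011-p10's B6, one call) and the certificate from the Q6 odd RECORD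
# `CensusQ6.GordOddFirstUnitIndexAt W p 1` (n1011-p06's Pal-free interlock) (cell `b2b-bsdres`, team n1011,
# seat p17 gen 2; sequel of `GordRankOneKatoBranchGrossZagierOdd.lean`; the `p ≥ 7` sibling of
# n1011-p12's `p = 3` record forms `…_three_iff_…_of_not_dvd`)

HONEST FRAMING (cell `b2b-bsdres`, run/shared/lean/b2b/bsd-rank1-residual/, verbatim in every
file): the goal of the cell is to DELETE the COMBINATION-SHAPED residual classes of the
Birch–Swinnerton-Dyer formula for ALL analytic-rank `≤ 1` elliptic curves over `ℚ` — "full BSD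
formula for every rank `≤ 1` curve in class `C`" assembled STRICTLY from published theorems — so
that the rank-`≤ 1` remainder becomes exactly the CONSTRUCTION-SHAPED classes, which are TYPED
(missing-input `Prop`s), NOT attempted. This is not "finishing BSD". Team n1011 (RESIDUAL-MAP §I
O7-ord, (G-ord) share, odd primes `p ≥ 7`): research route; no claim beyond stated classes; census
output = EVIDENCE / conjecture items, never a Literature fact; RESIDUAL-MAP marks change only by
signed lines. X4♯/X3♯(G-ord) CONSTRUCTION-SHAPED; §I O7 OPEN; nothing booked; no label changes.
THEOREMS ONLY (NO definition, NO fact, NO `_holds`); named facts as HYPOTHESES (`hK` Kato 17.4 (3)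
half-eigen reading / `hWu` Wuthrich Thm. 16 / GZK / modularity — all PUBLISHED; NO Pal: the Q6 odd
record constructor is n1011-p06's Pal-free
`branchUnitCertificateAt_of_gordOddFirstUnitIndexAt_one_of_mod_four_eq_three`). The Q6 record and `a_p(E♭)` are
per-pair census data — EVIDENCE when instantiated. `#print axioms` standard.

COVERAGE (stated first): per pair, `W/ℚ` globally minimal, `ClassX4Gord W p` (resp. `ClassX3Gord W p`),
`semistabilityIndex W p = 2`, `p ≡ 3 (mod 4)`, `5 ≤ p`, `ρ̄_{E,p}` onto (X4 only), `r_an = 1`, a good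
model `V` of `E♭ = E ⊗ χ_{−p}` with `¬ p ∣ a_p(V) − 1` (= `ReductionNonAnomalous W p` by p10's
`reductionNonAnomalous_iff_not_dvd_frobeniusTrace_sub_one_of_semistabilityIndex_eq_two`), the UNIT
certificate resp. the Q6 odd record, `Dh` a (B)-datum.

References: [Kato2004Asterisque] Thm. 17.4 (3) (p. 273); [Wuthrich2014] Thm. 16 (p. 397);
[Delbourgo2002] Thm. (B) (p. 40), p. 39 (ℓ_p); [Mazur1972] §1; [MazurTateTeitelbaum1986Invent] §I.13;
[Miller2011LMS] Def. 1.1.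
-/

noncomputable section

open scoped Classical MatrixGroups ModularForm NumberField

namespace Summit.BirchSwinnertonDyer.Rank1Residual.Additive

open CongruenceSubgroup WeierstrassCurve NumberField Literature.NumberTheory.EllipticCurves
  Literature.NumberTheory.EllipticCurves.ModularForms
  Literature.NumberTheory.EllipticCurves.Rank1Residual
  Literature.NumberTheory.EllipticCurves.Rank1Residual.Typed
  Literature.NumberTheory.EllipticCurves.Delbourgo2002
  Literature.NumberTheory.GaloisRepresentations Summit.BirchSwinnertonDyer.Rank1Residual.AdditivePotMult
  IsDedekindDomain

variable {W : WeierstrassCurve ℚ} [W.IsElliptic] [W.IsGloballyMinimal] {p : ℕ} [hp : Fact p.Prime]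

/-! ### §1 The non-anomalous binder as the census literal `¬ p ∣ a_p(E♭) − 1` -/

/-- B6 on a defect-2 row at odd `p`, twist literal `−p` (`p ≡ 3 (mod 4)`): `ReductionNonAnomalous W p`
from `¬ p ∣ a_p(V) − 1` for a good model `V` of `E ⊗ χ_{−p}` — the ONE-LINE `.mpr` of n1011-p10's
`reductionNonAnomalous_iff_not_dvd_frobeniusTrace_sub_one_of_semistabilityIndex_eq_two` BY NAME.
[cite: Delbourgo2002, p. 39 (ℓ_p(E))] [cite: Mazur1972, §1 (anomalous primes)] -/
theorem reductionNonAnomalous_of_mod_four_eq_three_of_not_dvd (hp4 : p % 4 = 3)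
    (he : semistabilityIndex W p = 2) (V : WeierstrassCurve ℚ) [V.IsElliptic] [V.IsGloballyMinimal]
    (hWV : ∃ C : VariableChange ℚ, C • V.quadraticTwist (-(p : ℚ)) = W)
    (hV : V.HasGoodReductionAtPrime p) (ha : ¬ (p : ℤ) ∣ V.frobeniusTrace p - 1) :
    ReductionNonAnomalous W p := by
  obtain ⟨hps, -⟩ := pStar_eq_neg_and_not_even_of_mod_four_eq_three (p := p) hp4
  have hWV' : ∃ C : VariableChange ℚ, C • V.quadraticTwist ((-1 : ℚ) ^ (p / 2) * p) = W := by
    rw [hps]; exact hWV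
  exact (reductionNonAnomalous_iff_not_dvd_frobeniusTrace_sub_one_of_semistabilityIndex_eq_two W p
    (by omega) he V hWV' hV).mpr ha

/-- **X4♯(G-ord), `p ≡ 3 (mod 4)`, `p ≥ 7`, rank one, census-literal non-anomalous binder**: as
`ClassX4Gord.branchPAdicGrossZagierOddAt_iff_bsdp_of_katoHalf_of_cert` with `ReductionNonAnomalous W p`
replaced by `¬ p ∣ a_p(V) − 1` for a good model `V` of `E ⊗ χ_{−p}`.
[cite: Kato2004Asterisque, Thm. 17.4 (3) (p. 273)] [cite: Delbourgo2002, Theorem (B) (p. 40), p. 39]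
[cite: Miller2011LMS, Def. 1.1] -/
theorem ClassX4Gord.branchPAdicGrossZagierOddAt_iff_bsdp_of_katoHalf_of_cert_of_not_dvd
    (hK : Wuthrich2014.kato_halfEigenCharIdeal_dvd_cyclotomicPrime_of_surjective)
    (hmodD : nonempty_modularParametrizationData)
    (hGZK : rank_eq_analyticRank_of_analyticRank_le_one) (hmod : hasEntireLFunction_rat)
    (hX : ClassX4Gord W p) (hp4 : p % 4 = 3) (hp5 : 5 ≤ p)
    (he : semistabilityIndex W p = 2) (hsurj : Surj W p) (hr : W.analyticRank = 1)
    (V : WeierstrassCurve ℚ) [V.IsElliptic] [V.IsGloballyMinimal]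
    (hWV : ∃ C : VariableChange ℚ, C • V.quadraticTwist (-(p : ℚ)) = W)
    (hV : V.HasGoodReductionAtPrime p) (ha : ¬ (p : ℤ) ∣ V.frobeniusTrace p - 1)
    (hcert : BranchUnitCertificateAt W p)
    {Dh : PAdicHeightData W p} (hB : LeadingTermClauses W p Dh) :
    BranchPAdicGrossZagierOddAt W p Dh ↔ BSDp W p :=
  hX.branchPAdicGrossZagierOddAt_iff_bsdp_of_katoHalf_of_cert hK hmodD hGZK hmod hp4 hp5 he hsurj hr
    (reductionNonAnomalous_of_mod_four_eq_three_of_not_dvd hp4 he V hWV hV ha) hcert hB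

/-- **X3♯(G-ord) twin, census-literal non-anomalous binder** (Wuthrich Thm. 16 `hWu`; NO surj).
[cite: Wuthrich2014, Thm. 16 (p. 397)] [cite: Delbourgo2002, Theorem (B) (p. 40), p. 39]
[cite: Miller2011LMS, Def. 1.1] -/
theorem ClassX3Gord.branchPAdicGrossZagierOddAt_iff_bsdp_of_wuthrichHalf_of_cert_of_not_dvd
    (hWu : Wuthrich2014.thm16_halfEigenCharIdeal_dvd_cyclotomicPrime)
    (hmodD : nonempty_modularParametrizationData)
    (hGZK : rank_eq_analyticRank_of_analyticRank_le_one) (hmod : hasEntireLFunction_rat)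
    (hX : ClassX3Gord W p) (hp4 : p % 4 = 3) (hp5 : 5 ≤ p)
    (he : semistabilityIndex W p = 2) (hr : W.analyticRank = 1)
    (V : WeierstrassCurve ℚ) [V.IsElliptic] [V.IsGloballyMinimal]
    (hWV : ∃ C : VariableChange ℚ, C • V.quadraticTwist (-(p : ℚ)) = W)
    (hV : V.HasGoodReductionAtPrime p) (ha : ¬ (p : ℤ) ∣ V.frobeniusTrace p - 1)
    (hcert : BranchUnitCertificateAt W p)
    {Dh : PAdicHeightData W p} (hB : LeadingTermClauses W p Dh) :
    BranchPAdicGrossZagierOddAt W p Dh ↔ BSDp W p :=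
  hX.branchPAdicGrossZagierOddAt_iff_bsdp_of_wuthrichHalf_of_cert hWu hmodD hGZK hmod hp4 hp5 he hr
    (reductionNonAnomalous_of_mod_four_eq_three_of_not_dvd hp4 he V hWV hV ha) hcert hB

/-! ### §2 The certificate from the Q6 odd RECORD, Pal-free
(n1011-p06's `branchUnitCertificateAt_of_gordOddFirstUnitIndexAt_one_of_mod_four_eq_three`) -/

/-- **X4♯(G-ord), `p ≡ 3 (mod 4)`, `p ≥ 7`, rank one, NON-ANOMALOUS: the Q6 odd RECORD
`CensusQ6.GordOddFirstUnitIndexAt W p 1` (first `p`-adic unit coefficient of `ϖ⁻·L_p(f♭, α, ω^{(p−1)/2}, T)`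
at index `1`) + Kato `hK` ⟹ `BranchPAdicGrossZagierOddAt W p Dh ↔ BSDp W p`** — Pal-free: the
certificate by n1011-p06's `branchUnitCertificateAt_of_gordOddFirstUnitIndexAt_one_of_mod_four_eq_three`
(constant term `0` from `L(E,1) = 0`, i.e. from `r_an = 1`). [cite: Kato2004Asterisque, Thm. 17.4 (3) (p. 273)]
[cite: Delbourgo2002, Theorem (B) (p. 40)] [cite: MazurTateTeitelbaum1986Invent, §I.13] [cite: Miller2011LMS, Def. 1.1] -/
theorem ClassX4Gord.branchPAdicGrossZagierOddAt_iff_bsdp_of_katoHalf_of_gordOddFirstUnitIndexAt_one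
    (hK : Wuthrich2014.kato_halfEigenCharIdeal_dvd_cyclotomicPrime_of_surjective)
    (hmodD : nonempty_modularParametrizationData)
    (hGZK : rank_eq_analyticRank_of_analyticRank_le_one) (hmod : hasEntireLFunction_rat)
    (hX : ClassX4Gord W p) (hp4 : p % 4 = 3) (hp5 : 5 ≤ p)
    (he : semistabilityIndex W p = 2) (hsurj : Surj W p) (hr : W.analyticRank = 1)
    (hna : ReductionNonAnomalous W p) (hrec : CensusQ6.GordOddFirstUnitIndexAt W p 1)
    {Dh : PAdicHeightData W p} (hB : LeadingTermClauses W p Dh) :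
    BranchPAdicGrossZagierOddAt W p Dh ↔ BSDp W p :=
  hX.branchPAdicGrossZagierOddAt_iff_bsdp_of_katoHalf_of_cert hK hmodD hGZK hmod hp4 hp5 he hsurj hr hna
    (branchUnitCertificateAt_of_gordOddFirstUnitIndexAt_one_of_mod_four_eq_three hmod hp4 hX.addv.2
      (entireLFunction_one_eq_zero_of_analyticRank_ne_zero hmod (by rw [hr]; exact one_ne_zero)) hrec) hB

/-- **X3♯(G-ord) twin from the Q6 odd RECORD** (Wuthrich Thm. 16; NO surj).
[cite: Wuthrich2014, Thm. 16 (p. 397)] [cite: Delbourgo2002, Theorem (B) (p. 40)]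
[cite: MazurTateTeitelbaum1986Invent, §I.13] [cite: Miller2011LMS, Def. 1.1] -/
theorem ClassX3Gord.branchPAdicGrossZagierOddAt_iff_bsdp_of_wuthrichHalf_of_gordOddFirstUnitIndexAt_one
    (hWu : Wuthrich2014.thm16_halfEigenCharIdeal_dvd_cyclotomicPrime)
    (hmodD : nonempty_modularParametrizationData)
    (hGZK : rank_eq_analyticRank_of_analyticRank_le_one) (hmod : hasEntireLFunction_rat)
    (hX : ClassX3Gord W p) (hp4 : p % 4 = 3) (hp5 : 5 ≤ p)
    (he : semistabilityIndex W p = 2) (hr : W.analyticRank = 1)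
    (hna : ReductionNonAnomalous W p) (hrec : CensusQ6.GordOddFirstUnitIndexAt W p 1)
    {Dh : PAdicHeightData W p} (hB : LeadingTermClauses W p Dh) :
    BranchPAdicGrossZagierOddAt W p Dh ↔ BSDp W p :=
  hX.branchPAdicGrossZagierOddAt_iff_bsdp_of_wuthrichHalf_of_cert hWu hmodD hGZK hmod hp4 hp5 he hr hna
    (branchUnitCertificateAt_of_gordOddFirstUnitIndexAt_one_of_mod_four_eq_three hmod hp4 hX.addv
      (entireLFunction_one_eq_zero_of_analyticRank_ne_zero hmod (by rw [hr]; exact one_ne_zero)) hrec) hB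

/-- **Both census literals at once** (X4♯(G-ord), `p ≡ 3 (mod 4)`, `p ≥ 7`, rank one): the Q6 odd
record + `¬ p ∣ a_p(E♭) − 1` + Kato ⟹ `BranchPAdicGrossZagierOddAt W p Dh ↔ BSDp W p`.
[cite: Kato2004Asterisque, Thm. 17.4 (3) (p. 273)] [cite: Delbourgo2002, Theorem (B) (p. 40), p. 39]
[cite: Miller2011LMS, Def. 1.1] -/
theorem ClassX4Gord.branchPAdicGrossZagierOddAt_iff_bsdp_of_katoHalf_of_gordOddFirstUnitIndexAt_one_of_not_dvd
    (hK : Wuthrich2014.kato_halfEigenCharIdeal_dvd_cyclotomicPrime_of_surjective)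
    (hmodD : nonempty_modularParametrizationData)
    (hGZK : rank_eq_analyticRank_of_analyticRank_le_one) (hmod : hasEntireLFunction_rat)
    (hX : ClassX4Gord W p) (hp4 : p % 4 = 3) (hp5 : 5 ≤ p)
    (he : semistabilityIndex W p = 2) (hsurj : Surj W p) (hr : W.analyticRank = 1)
    (V : WeierstrassCurve ℚ) [V.IsElliptic] [V.IsGloballyMinimal]
    (hWV : ∃ C : VariableChange ℚ, C • V.quadraticTwist (-(p : ℚ)) = W)
    (hV : V.HasGoodReductionAtPrime p) (ha : ¬ (p : ℤ) ∣ V.frobeniusTrace p - 1)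
    (hrec : CensusQ6.GordOddFirstUnitIndexAt W p 1)
    {Dh : PAdicHeightData W p} (hB : LeadingTermClauses W p Dh) :
    BranchPAdicGrossZagierOddAt W p Dh ↔ BSDp W p :=
  hX.branchPAdicGrossZagierOddAt_iff_bsdp_of_katoHalf_of_gordOddFirstUnitIndexAt_one hK hmodD hGZK hmod
    hp4 hp5 he hsurj hr (reductionNonAnomalous_of_mod_four_eq_three_of_not_dvd hp4 he V hWV hV ha)
    hrec hB

end Summit.BirchSwinnertonDyer.Rank1Residual.Additive

end
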